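import Summits.KontsevichZagierPeriods.KontsevichZagierPeriods.Theorems.LinRedNormalFormArrangementNormalFormStubRebaseSimpleZeroProductFibre

/-!
# Stub `stub_rebaseSimpleZeroTwo`, part `rebaseSimpleZero_product` (crux `ArrangementNormalForm`, line `janus-bands`) — the part

The PRODUCT case of the rebase over a ONE-dimensional base `y` with a simple base pole and any
number `k` of fibres (literal class `GS 0 k`, every fibre bound an affine function of `y`):
`GS 0 k`-data with product fibres are congruent modulo `KZ.relations` to `ℤ`-combinations of
elements of the rebased class `GG 0 2 k` (constant letters, bounds constant or exactly `y`).
* `RebaseZero.good_of_card_le` / `RebaseZero.good_isProd` — the INDUCTION over the fibres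
  discharging the continuation hypothesis `RebaseZero.HP`: induction on the number of fibres not
  yet in format; processing one fibre (`RebaseZero.good_fibre`, part `Fibre`) puts it in format
  and leaves the spectators unchanged, the base case is the packaging lemma
  `RebaseZero.good_of_allFmt`;
* `RebaseZero.isProd_of_literal` — READING a literal `GS 0 k` product datum as a product
  representation: the `k` redundant rows `Vᵢ − Uᵢ > 0` are appended to the base cell (same
  domain, `RebaseZero.pDom_append`), which makes the base cell the projection of the (bounded)
  domain, hence bounded (`RebaseZero.cell_append_bdd`);
* `RebaseZero.good_literal` — the statement on the literal class `SeparatePos.GGset 0 2 k`;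
* `rebaseSimpleZero_product` — the registered part (skeleton spelling `GG`, `hGG`).

References: M. Kontsevich, D. Zagier, *Periods* (2001), §1.2.
-/

noncomputable section

open Set MeasureTheory MvPolynomial
open Literature.NumberTheory.Transcendental Literature.ModelTheory.ExponentialFields

namespace Summit.KontsevichZagierPeriods.ArrangementNormalForm.JanusBands

namespace RebaseZero

open SeparatePos RebasePos

variable {k : ℕ}

/-! ### The induction over the fibres -/

/-- **The fibre-by-fibre induction.** A product representation at most `n` of whose fibres are
not in format is good: process one unformatted fibre (`good_fibre`); the continuation hypothesis
is the induction hypothesis, since the processed fibre is then in format and the spectators are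
unchanged. [folklore] -/
theorem good_of_card_le (T : BData) (n : ℕ) : ∀ {m' : ℕ} (s : KZ.IntegralRep (0 + 1 + k))
    (M : Fin m' → Cf) (U V : Fin k → Cf) (p : MvPolynomial (Fin 0) ℚ) (a : Fin k → Option Cf),
    IsProd s M U V T p a → ∀ S : Finset (Fin k), S.card ≤ n →
    (∀ j, j ∉ S → InFmt (a j) (U j) (V j)) → Good k (KZ.of s) := by
  induction n with
  | zero =>
    intro m' s M U V p a h S hS hf
    have hS' : S = ∅ := Finset.card_eq_zero.1 (Nat.le_zero.1 hS)
    exact good_of_allFmt h fun j => hf j (by simp [hS'])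
  | succ n ih =>
    intro m' s M U V p a h S hS hf
    by_cases hall : ∀ j ∈ S, InFmt (a j) (U j) (V j)
    · refine good_of_allFmt h fun j => ?_
      by_cases hj : j ∈ S
      · exact hall j hj
      · exact hf j hj
    push Not at hall
    obtain ⟨i, hi, -⟩ := hall
    refine good_fibre h i fun m'' s' M' U' V' p' a' h' hfi hs => ?_
    refine ih s' M' U' V' p' a' h' (S.erase i) ?_ fun j hj => ?_
    · rw [Finset.card_erase_of_mem hi]; omega
    · by_cases hji : j = i
      · subst hji; exact hfi
      · obtain ⟨h1, h2, h3⟩ := hs j hji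
        rw [h1, h2, h3]
        exact hf j fun hjS => hj (Finset.mem_erase.2 ⟨hji, hjS⟩)

/-- **Every product representation over a one-dimensional base is good.** [folklore] -/
theorem good_isProd {s : KZ.IntegralRep (0 + 1 + k)} {m' : ℕ} {M : Fin m' → Cf} {U V : Fin k → Cf}
    {T : BData} {p : MvPolynomial (Fin 0) ℚ} {a : Fin k → Option Cf} (h : IsProd s M U V T p a) :
    Good k (KZ.of s) :=
  good_of_card_le T k s M U V p a h Finset.univ (by simp) fun j hj => absurd (Finset.mem_univ j) hj

/-! ### Reading the literal datum -/

/-- Membership in the base cell with the `k` redundant rows `Vᵢ − Uᵢ` appended. [folklore] -/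
theorem mem_cell_append {m' : ℕ} (M : Fin m' → Cf) (U V : Fin k → Cf) (y : ℝ) :
    y ∈ cell (Fin.append M (fun i => V i - U i) : Fin (m' + k) → Cf) ↔
      y ∈ cell M ∧ ∀ i, ev (U i) y < ev (V i) y := by
  simp only [cell, mem_setOf_eq]
  constructor
  · intro h
    refine ⟨fun j => ?_, fun i => ?_⟩
    · simpa only [Fin.append_left] using h (Fin.castAdd k j)
    · have := h (Fin.natAdd m' i)
      rwa [Fin.append_right, ev_sub, sub_pos] at this
  · rintro ⟨h1, h2⟩ j
    refine Fin.addCases (fun j => ?_) (fun i => ?_) j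
    · rw [Fin.append_left]; exact h1 j
    · rw [Fin.append_right, ev_sub, sub_pos]; exact h2 i

/-- Appending the redundant rows does not change the product domain. [folklore] -/
theorem pDom_append {m' : ℕ} (M : Fin m' → Cf) (U V : Fin k → Cf) :
    pDom (Fin.append M (fun i => V i - U i) : Fin (m' + k) → Cf) U V = pDom M U V := by
  ext z
  rw [mem_pDom, mem_pDom, mem_cell_append]
  constructor
  · rintro ⟨⟨hy, -⟩, hf⟩; exact ⟨hy, hf⟩
  · rintro ⟨hy, hf⟩; exact ⟨⟨hy, fun i => (hf i).1.trans (hf i).2⟩, hf⟩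

/-- **The extended base cell is bounded** as soon as the product domain is: it is the
projection of the domain (lift `y` to the point with every fibre at mid-height). [folklore] -/
theorem cell_append_bdd {m' : ℕ} (M : Fin m' → Cf) (U V : Fin k → Cf)
    (hbd : Bornology.IsBounded (pDom M U V)) :
    ∃ R : ℝ, ∀ y ∈ cell (Fin.append M (fun i => V i - U i) : Fin (m' + k) → Cf), |y| ≤ R := by
  obtain ⟨R, hR⟩ := hbd.exists_norm_le
  refine ⟨R, fun y hy => ?_⟩
  rw [mem_cell_append] at hy
  set z : Fin (0 + 1 + k) → ℝ :=
    Fin.append (fun _ : Fin (0 + 1) => y) (fun i => (ev (U i) y + ev (V i) y) / 2) with hzdef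
  have hyv : yv z = y := by simp only [yv, yIdx, hzdef, Fin.append_left]
  have htv : ∀ i, tv z i = (ev (U i) y + ev (V i) y) / 2 := fun i => by
    simp only [tv, tIdx, hzdef, Fin.append_right]
  have hz : z ∈ pDom M U V := by
    rw [mem_pDom, hyv]
    refine ⟨hy.1, fun i => ?_⟩
    rw [htv]
    constructor <;> linarith [hy.2 i]
  have h1 := norm_le_pi_norm z (yIdx k)
  rw [Real.norm_eq_abs, show z (yIdx k) = y from hyv] at h1
  exact h1.trans (hR _ hz)

/-- **Reading a literal product datum** (affine bounds `Uᵢ < tᵢ < Vᵢ`, literal domain and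
integrand, bounded domain) as a product representation over the extended base cell. [folklore] -/
theorem isProd_of_literal {m m' n₁ n₂ : ℕ} (s : KZ.IntegralRep (0 + 1 + k)) (M : Fin m' → Cf)
    (L : Fin m → (Fin 0 → ℚ) × ℚ) (e : Fin m → ℕ) (p : MvPolynomial (Fin 0) ℚ)
    (ℓ₁ ℓ₂ : (Fin 0 → ℚ) × ℚ) (a : Fin k → Option Cf) (lo hi : Fin k → Fin k ⊕ Cf)
    (U V : Fin k → Cf) (hlo : ∀ i, lo i = Sum.inr (U i)) (hhi : ∀ i, hi i = Sum.inr (V i))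
    (h12 : n₁ = 0 ∨ n₂ = 0) (hbd : Bornology.IsBounded s.domain)
    (hdom : s.domain = gDom 0 k m' M lo hi)
    (hint : EqOn s.integrand (glit 0 k p L e ℓ₁ ℓ₂ n₁ n₂ a) s.domain) :
    IsProd s (Fin.append M (fun i => V i - U i) : Fin (m' + k) → Cf) U V ⟨m, L, e, ℓ₁, ℓ₂, n₁, n₂⟩ p a := by
  have hlo' : lo = fun i => Sum.inr (U i) := funext hlo
  have hhi' : hi = fun i => Sum.inr (V i) := funext hhi
  have hd : s.domain = pDom M U V := by rw [hdom, hlo', hhi']; rfl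
  have hbd' : Bornology.IsBounded (pDom M U V) := hd ▸ hbd
  exact ⟨by rw [pDom_append, hd], hint, h12, cell_append_bdd M U V hbd'⟩

/-- **The product case on the literal class.** A representation with a literal `GS 0 k` datum
(any `n₁ n₂` with `n₁ = 0 ∨ n₂ = 0`) all of whose fibre bounds are affine forms of the base
(`hprod`) is congruent modulo `KZ.relations` to a `ℤ`-combination of elements of the literal
rebased class `SeparatePos.GGset 0 2 k`. [folklore] -/
theorem good_literal {m m' n₁ n₂ : ℕ} (s : KZ.IntegralRep (0 + 1 + k)) (M : Fin m' → Cf)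
    (L : Fin m → (Fin 0 → ℚ) × ℚ) (e : Fin m → ℕ) (p : MvPolynomial (Fin 0) ℚ)
    (ℓ₁ ℓ₂ : (Fin 0 → ℚ) × ℚ) (a : Fin k → Option Cf) (lo hi : Fin k → Fin k ⊕ Cf)
    (h12 : n₁ = 0 ∨ n₂ = 0) (hprod : ∀ i, (∃ c, lo i = Sum.inr c) ∧ (∃ c, hi i = Sum.inr c))
    (hbd : Bornology.IsBounded s.domain) (hdom : s.domain = gDom 0 k m' M lo hi)
    (hint : EqOn s.integrand (glit 0 k p L e ℓ₁ ℓ₂ n₁ n₂ a) s.domain) :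
    ∃ c ∈ AddSubgroup.closure (GGset 0 2 k), KZ.of s - c ∈ KZ.relations := by
  choose U hU using fun i => (hprod i).1
  choose V hV using fun i => (hprod i).2
  exact good_isProd (isProd_of_literal s M L e p ℓ₁ ℓ₂ a lo hi U V hU hV h12 hbd hdom hint)

end RebaseZero

/-- **Registered part `rebaseSimpleZero_product` of `stub_rebaseSimpleZeroTwo` (line
`janus-bands`): product fibres, any number `k` of fibres.** A representation with the literal
`GS 0 k` datum (one base coordinate `y` in a bounded rational cell, base factor
`p/∏ Lⱼ^{eⱼ} · (y − ℓ₁)^{n₁}/(y − ℓ₂)^{n₂}`, `k` fibres `tᵢ` with optional letters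
`1/(tᵢ − cᵢ(y))`) all of whose fibre bounds are affine forms of `y` (`hprod`: no mutual bound)
is congruent modulo `KZ.relations` to a `ℤ`-combination of elements of `GG 0 2 k` (constant
letters, bounds constant or exactly `y`): read the datum as a product representation
(`RebaseZero.isProd_of_literal`) and run the fibre-by-fibre induction (`RebaseZero.good_isProd`:
each fibre is dissected along its letter and the sign walls of `Uᵢ − cᵢ`, `Vᵢ − cᵢ`, reflected,
sheared, Janus-split or blown up until it is in format, the other fibres riding along). -/
theorem rebaseSimpleZero_product (GG : ℕ → ℕ → ℕ → Set KZ.FormalRep) (hGG : ∀ b σ k, GG b σ k = {w : KZ.FormalRep | ∃ (m m' n₁ n₂ : ℕ) (s : KZ.IntegralRep (b + 1 + k)) (M : Fin m' → (Fin (b + 1) → ℚ) × ℚ) (L : Fin m → (Fin b → ℚ) × ℚ) (e : Fin m → ℕ) (p : MvPolynomial (Fin b) ℚ) (ℓ₁ ℓ₂ : (Fin b → ℚ) × ℚ) (a : Fin k → Option ((Fin (b + 1) → ℚ) × ℚ)) (lo hi : Fin k → Fin k ⊕ ((Fin (b + 1) → ℚ) × ℚ)), (n₁ = 0 ∨ n₂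 = 0) ∧ (σ = 2 → (∀ i c, a i = some c → c.1 (Fin.last b) = 0) ∧ (∀ i c, (lo i = Sum.inr c ∨ hi i = Sum.inr c) → (c.1 (Fin.last b) = 0 ∨ c = (Pi.single (Fin.last b) 1, 0)))) ∧ Bornology.IsBounded s.domain ∧ s.domain = {z | (∀ j, 0 < ∑ i, ((M j).1 i : ℝ) * z (Fin.castAdd k i) + ((M j).2 : ℝ)) ∧ ∀ i, Sum.elim (fun j => z (Fin.natAdd (b + 1) j)) (fun c => ∑ i', (c.1 i' : ℝ) * z (Fin.castAdd k i') + (c.2 : ℝ)) (lo i) < z (Fin.natAdd (b + 1) i) ∧ z (Fin.natAdd (b + 1) i) < Sum.elim (fun j => z (Fin.natAdd (b + 1) j)) (fun c => ∑ i', (c.1 i' : ℝ) * z (Fin.castAdd k i') + (c.2 : ℝ)) (hi i)} ∧ EqOn s.integrand (fun z => MvPolynomial.aeval (fun i => z (Fin.castAdd k (Fin.castSucc i))) p / (∏ j, (∑ i, ((L j).1 i : ℝ) * z (Fin.castAdd k (Fin.castSucc i)) + ((L j).2 : ℝ)) ^ e j) * ((z (Fin.castAdd k (Fin.last b)) - (∑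 i, (ℓ₁.1 i : ℝ) * z (Fin.castAdd k (Fin.castSucc i)) + (ℓ₁.2 : ℝ))) ^ n₁ / (z (Fin.castAdd k (Fin.last b)) - (∑ i, (ℓ₂.1 i : ℝ) * z (Fin.castAdd k (Fin.castSucc i)) + (ℓ₂.2 : ℝ))) ^ n₂) * ∏ i, (a i).elim 1 (fun c => 1 / (z (Fin.natAdd (b + 1) i) - (∑ i', (c.1 i' : ℝ) * z (Fin.castAdd k i') + (c.2 : ℝ))))) s.domain ∧ w = KZ.of s}) (k m m' n₁ n₂ : ℕ) (s : KZ.IntegralRep (0 + 1 + k)) (M : Fin m' → (Fin (0 + 1) → ℚ) × ℚ) (L : Fin m → (Fin 0 → ℚ) × ℚ) (e : Fin m → ℕ) (p : MvPolynomial (Fin 0) ℚ) (ℓ₁ ℓ₂ : (Fin 0 → ℚ) × ℚ) (a : Fin k → Option ((Fin (0 + 1) → ℚ) × ℚ)) (lo hi : Fin k → Fin k ⊕ ((Fin (0 + 1) → ℚ) × ℚ)) (h12 : n₁ = 0 ∨ n₂ = 0) (hn : n₂ = 1) (hprod : ∀ i, (∃ c, lo i = Sum.inr c) ∧ (∃ c,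 hi i = Sum.inr c)) (hbd : Bornology.IsBounded s.domain) (hdom : s.domain = {z | (∀ j, 0 < ∑ i, ((M j).1 i : ℝ) * z (Fin.castAdd k i) + ((M j).2 : ℝ)) ∧ ∀ i, Sum.elim (fun j => z (Fin.natAdd (0 + 1) j)) (fun c => ∑ i', (c.1 i' : ℝ) * z (Fin.castAdd k i') + (c.2 : ℝ)) (lo i) < z (Fin.natAdd (0 + 1) i) ∧ z (Fin.natAdd (0 + 1) i) < Sum.elim (fun j => z (Fin.natAdd (0 + 1) j)) (fun c => ∑ i', (c.1 i' : ℝ) * z (Fin.castAdd k i') + (c.2 : ℝ)) (hi i)}) (hint : EqOn s.integrand (fun z => MvPolynomial.aeval (fun i => z (Fin.castAdd k (Fin.castSucc i))) p / (∏ j, (∑ i, ((L j).1 i : ℝ) * z (Fin.castAdd k (Fin.castSucc i)) + ((L j).2 : ℝ)) ^ e j) * ((z (Fin.castAdd k (Fin.last 0)) - (∑ i, (ℓ₁.1 i : ℝ) * z (Fin.castAdd k (Fin.castSucc i)) + (ℓ₁.2 : ℝ))) ^ n₁ / (z (Fin.castAdd k (Fin.last 0)) - (∑ i, (ℓ₂.1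 i : ℝ) * z (Fin.castAdd k (Fin.castSucc i)) + (ℓ₂.2 : ℝ))) ^ n₂) * ∏ i, (a i).elim 1 (fun c => 1 / (z (Fin.natAdd (0 + 1) i) - (∑ i', (c.1 i' : ℝ) * z (Fin.castAdd k i') + (c.2 : ℝ))))) s.domain) : ∃ c ∈ AddSubgroup.closure (GG 0 2 k), KZ.of s - c ∈ KZ.relations := by
  subst hn
  rw [show GG 0 2 k = SeparatePos.GGset 0 2 k from hGG 0 2 k]
  exact RebaseZero.good_literal s M L e p ℓ₁ ℓ₂ a lo hi h12 hprod hbd hdom hint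

/-- The same on the literal class `SeparatePos.GGset 0 2 k` (no `hGG`, any admissible
`n₁ n₂`): the product case of the rebase over a one-dimensional base, literal binders. -/
theorem rebaseSimpleZero_productGGset (k m m' n₁ n₂ : ℕ) (s : KZ.IntegralRep (0 + 1 + k)) (M : Fin m' → (Fin (0 + 1) → ℚ) × ℚ) (L : Fin m → (Fin 0 → ℚ) × ℚ) (e : Fin m → ℕ) (p : MvPolynomial (Fin 0) ℚ) (ℓ₁ ℓ₂ : (Fin 0 → ℚ) × ℚ) (a : Fin k → Option ((Fin (0 + 1) → ℚ) × ℚ)) (lo hi : Fin k → Fin k ⊕ ((Fin (0 + 1) → ℚ) × ℚ)) (h12 : n₁ = 0 ∨ n₂ = 0) (hprod : ∀ i, (∃ c, lo i = Sum.inr c) ∧ (∃ c, hi i = Sum.inr c)) (hbd : Bornology.IsBounded s.domain) (hdom : s.domain = {z | (∀ j, 0 < ∑ i, ((M j).1 i : ℝ) * z (Fin.castAdd k i) + ((M j).2 : ℝ)) ∧ ∀ i, Sum.elim (fun j => z (Fin.natAdd (0 + 1) j)) (fun c => ∑ i', (c.1 i' : ℝ) * z (Fin.castAdd k i') + (c.2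 : ℝ)) (lo i) < z (Fin.natAdd (0 + 1) i) ∧ z (Fin.natAdd (0 + 1) i) < Sum.elim (fun j => z (Fin.natAdd (0 + 1) j)) (fun c => ∑ i', (c.1 i' : ℝ) * z (Fin.castAdd k i') + (c.2 : ℝ)) (hi i)}) (hint : EqOn s.integrand (fun z => MvPolynomial.aeval (fun i => z (Fin.castAdd k (Fin.castSucc i))) p / (∏ j, (∑ i, ((L j).1 i : ℝ) * z (Fin.castAdd k (Fin.castSucc i)) + ((L j).2 : ℝ)) ^ e j) * ((z (Fin.castAdd k (Fin.last 0)) - (∑ i, (ℓ₁.1 i : ℝ) * z (Fin.castAdd k (Fin.castSucc i)) + (ℓ₁.2 : ℝ))) ^ n₁ / (z (Fin.castAdd k (Fin.last 0)) - (∑ i, (ℓ₂.1 i : ℝ) * z (Fin.castAdd k (Fin.castSucc i)) + (ℓ₂.2 : ℝ))) ^ n₂) * ∏ i, (a i).elim 1 (fun c => 1 / (z (Fin.natAdd (0 + 1) i) - (∑ i', (c.1 i' : ℝ) * z (Fin.castAdd k i') + (c.2 : ℝ))))) s.domain) : ∃ c ∈ AddSubgroup.closure (SeparatePos.GGset 0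 2 k), KZ.of s - c ∈ KZ.relations :=
  RebaseZero.good_literal s M L e p ℓ₁ ℓ₂ a lo hi h12 hprod hbd hdom hint

end Summit.KontsevichZagierPeriods.ArrangementNormalForm.JanusBands
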